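import Literature.NumberTheory.Automorphic.WhittakerDecayArchLine
import Literature.NumberTheory.Automorphic.IterLieDerivUniformBound
import Mathlib.Analysis.CStarAlgebra.Matrix
import HarnessLib

/-!
# Decay of Whittaker functions in the archimedean Iwasawa coordinates:
# `|W_φ(g)| ≤ C_m · (a_{k+1,w} / a_{k,w})^m`

Topic `NumberTheory/Automorphic`; namespace `Literature.NumberTheory.Automorphic`. Sequel of
`WhittakerDecayArchLine` (the basic inequality `‖W_φ(g)‖ (2π|Tr b_{k-1,k}|)^m ≤ ‖X'^m φ‖_∞` along the
twisted direction `X' = Ad(g_∞⁻¹)(blockMatrixOf b)`) and `IterLieDerivUniformBound` (bounds for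
iterated Lie derivatives uniform in directions of bounded norm). For a left `GL_n(K)`-invariant `φ`
all of whose iterated Lie derivatives are archimedean-smooth, continuous and bounded (e.g. a cusp form
of uniformly moderate growth), an infinite place `w` of `K` and `0 < k < n`, we take for `b` the unit
block direction at the position `(k-1, k)` and the place `w` (`unitBlockDir`, built on the unit vector
`archUnitAt K w ∈ K_∞ = ℝ^{r₁} × ℂ^{r₂}`). If the archimedean component of `g` is `g_∞ = a · κ` with
`a = diag(d)` diagonal, positive real at `w` (`d_{i,w} = r_i > 0`), and `κ ∈ K_∞`, then
`X' = (r_k / r_{k-1}) · Ad(κ⁻¹) E^w_{k-1,k}` with `‖Ad(κ⁻¹) E^w_{k-1,k}‖ ≤ n²`, and we obtain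

* `exists_norm_whittakerDepth_zero_le_mul_pow` — **`‖W_φ(g)‖ ≤ C_m · (r_k / r_{k-1})^m`** for every
  `m`, with `C_m` independent of `g`, `d`, `κ`: the Whittaker function decays faster than any power of
  the simple-root character `a_{k-1}/a_k` of the torus part of `g_∞`, uniformly in the compact part.

This is the archimedean half of the estimate of Whittaker functions by which the Fourier expansion of
a cusp form converges absolutely (Cogdell (2004), Thm. 1.1; Moeglin–Waldspurger (1995), I.2.10–11;
Jacquet–Piatetski-Shapiro–Shalika (1979), §2 (gauge estimates) for `GL(3)`). The auxiliary
definitions `archUnitAt`, `mixedSpaceEvalAt`, `unitBlockDir` come with their unfolding lemmas;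
everything else is a theorem.

## References

* J. W. Cogdell, *Analytic theory of L-functions for GL_n*, in *An Introduction to the Langlands
  Program* (2004), §1.1, Thm. 1.1 [CogdellAnalyticTheory2004].
* C. Moeglin, J.-L. Waldspurger, *Spectral decomposition and Eisenstein series* (1995), I.2.10,
  I.2.11 [MoeglinWaldspurger1995].
-/

noncomputable section

open MeasureTheory NumberField NumberField.mixedEmbedding NumberField.InfinitePlace IsDedekindDomain Matrix
  Set Filter Topology Real
open scoped MatrixGroups ComplexConjugate Classical NNReal

namespace Literature.NumberTheory.Automorphic

/-! ### The unit vectors of `K_∞ = ℝ^{r₁} × ℂ^{r₂}` and evaluation at a place -/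

section Places

variable (K : Type) [Field K] [NumberField K]

/-- **The unit vector of `K_∞ = ℝ^{r₁} × ℂ^{r₂}` at the infinite place `w`**: `1` in the coordinate `w`
(real or complex), `0` elsewhere. [folklore] -/
def archUnitAt (w : InfinitePlace K) : mixedSpace K :=
  if hw : w.IsReal then (Pi.single ⟨w, hw⟩ 1, 0)
  else (0, Pi.single ⟨w, not_isReal_iff_isComplex.1 hw⟩ 1)

/-- **Evaluation of `K_∞` at the infinite place `w`, read in `ℂ`** (the real coordinate, coerced, at a
real place; the complex coordinate at a complex place); a ring homomorphism. [folklore] -/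
def mixedSpaceEvalAt (w : InfinitePlace K) : mixedSpace K →+* ℂ :=
  if hw : w.IsReal then Complex.ofRealHom.comp (mixedSpaceEvalReal K ⟨w, hw⟩)
  else mixedSpaceEvalComplex K ⟨w, not_isReal_iff_isComplex.1 hw⟩

variable {K}

omit [NumberField K] in
/-- `archUnitAt` at a real place. [folklore] -/
theorem archUnitAt_of_isReal {w : InfinitePlace K} (hw : w.IsReal) :
    archUnitAt K w = (Pi.single ⟨w, hw⟩ 1, 0) := by
  rw [archUnitAt, dif_pos hw]

omit [NumberField K] in
/-- `archUnitAt` at a complex place. [folklore] -/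
theorem archUnitAt_of_isComplex {w : InfinitePlace K} (hw : w.IsComplex) :
    archUnitAt K w = (0, Pi.single ⟨w, hw⟩ 1) := by
  rw [archUnitAt, dif_neg (not_isReal_iff_isComplex.2 hw)]

omit [NumberField K] in
/-- `mixedSpaceEvalAt` at a real place. [folklore] -/
theorem mixedSpaceEvalAt_of_isReal {w : InfinitePlace K} (hw : w.IsReal) (x : mixedSpace K) :
    mixedSpaceEvalAt K w x = ((x.1 ⟨w, hw⟩ : ℝ) : ℂ) := by
  rw [mixedSpaceEvalAt, dif_pos hw]
  rfl

omit [NumberField K] in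
/-- `mixedSpaceEvalAt` at a complex place. [folklore] -/
theorem mixedSpaceEvalAt_of_isComplex {w : InfinitePlace K} (hw : w.IsComplex) (x : mixedSpace K) :
    mixedSpaceEvalAt K w x = x.2 ⟨w, hw⟩ := by
  rw [mixedSpaceEvalAt, dif_neg (not_isReal_iff_isComplex.2 hw)]
  rfl

/-- **The trace of a unit vector is the multiplicity of the place**: `Tr(1_w) = 1` (real `w`) or `2`
(complex `w`); in particular `1 ≤ Tr(1_w)`. [folklore] -/
theorem one_le_mixedTrace_archUnitAt (w : InfinitePlace K) : 1 ≤ mixedTrace K (archUnitAt K w) := by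
  by_cases hw : w.IsReal
  · rw [archUnitAt_of_isReal hw, mixedTrace_apply]
    simp [Pi.single_apply]
  · rw [archUnitAt_of_isComplex (not_isReal_iff_isComplex.1 hw), mixedTrace_apply]
    simp [Pi.single_apply, apply_ite Complex.re]

/-- `‖1_w‖ ≤ 1` (sup norm of `ℝ^{r₁} × ℂ^{r₂}`). [folklore] -/
theorem norm_archUnitAt_le (w : InfinitePlace K) : ‖archUnitAt K w‖ ≤ 1 := by
  by_cases hw : w.IsReal
  · rw [archUnitAt_of_isReal hw, Prod.norm_def]
    refine max_le ?_ ?_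
    · refine (pi_norm_le_iff_of_nonneg zero_le_one).2 fun w' => ?_
      change ‖(Pi.single (⟨w, hw⟩ : {w : InfinitePlace K // w.IsReal}) (1 : ℝ) :
        {w : InfinitePlace K // w.IsReal} → ℝ) w'‖ ≤ 1
      rw [Pi.single_apply]
      split_ifs <;> simp
    · change ‖(0 : {w : InfinitePlace K // w.IsComplex} → ℂ)‖ ≤ 1
      simp
  · rw [archUnitAt_of_isComplex (not_isReal_iff_isComplex.1 hw), Prod.norm_def]
    refine max_le ?_ ?_
    · change ‖(0 : {w : InfinitePlace K // w.IsReal} → ℝ)‖ ≤ 1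
      simp
    · refine (pi_norm_le_iff_of_nonneg zero_le_one).2 fun w' => ?_
      change ‖(Pi.single (⟨w, not_isReal_iff_isComplex.1 hw⟩ : {w : InfinitePlace K // w.IsComplex}) (1 : ℂ) :
        {w : InfinitePlace K // w.IsComplex} → ℂ) w'‖ ≤ 1
      rw [Pi.single_apply]
      split_ifs <;> simp

omit [NumberField K] in
/-- **Elements which are real at `w` act on `1_w` by a real scalar**: if the `w`-coordinate of `x` is
the real number `ρ`, then `x · 1_w = ρ · 1_w`. [folklore] -/
theorem mul_archUnitAt_eq_smul {w : InfinitePlace K} {x : mixedSpace K} {ρ : ℝ}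
    (hx : mixedSpaceEvalAt K w x = (ρ : ℂ)) : x * archUnitAt K w = ρ • archUnitAt K w := by
  by_cases hw : w.IsReal
  · rw [mixedSpaceEvalAt_of_isReal hw, Complex.ofReal_inj] at hx
    rw [archUnitAt_of_isReal hw]
    refine Prod.ext (funext fun w' => ?_) (funext fun w' => ?_)
    · change x.1 w' * (Pi.single (⟨w, hw⟩ : {w : InfinitePlace K // w.IsReal}) (1 : ℝ) :
          {w : InfinitePlace K // w.IsReal} → ℝ) w' =
        ρ • (Pi.single (⟨w, hw⟩ : {w : InfinitePlace K // w.IsReal}) (1 : ℝ) :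
          {w : InfinitePlace K // w.IsReal} → ℝ) w'
      rw [Pi.single_apply, smul_eq_mul]
      split_ifs with h
      · subst h; rw [hx]
      · rw [mul_zero, mul_zero]
    · change x.2 w' * (0 : {w : InfinitePlace K // w.IsComplex} → ℂ) w' =
        ρ • (0 : {w : InfinitePlace K // w.IsComplex} → ℂ) w'
      simp
  · have hw' : w.IsComplex := not_isReal_iff_isComplex.1 hw
    rw [mixedSpaceEvalAt_of_isComplex hw'] at hx
    rw [archUnitAt_of_isComplex hw']
    refine Prod.ext (funext fun w' => ?_) (funext fun w' => ?_)
    · change x.1 w' * (0 : {w : InfinitePlace K // w.IsReal} → ℝ) w' =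
        ρ • (0 : {w : InfinitePlace K // w.IsReal} → ℝ) w'
      simp
    · change x.2 w' * (Pi.single (⟨w, hw'⟩ : {w : InfinitePlace K // w.IsComplex}) (1 : ℂ) :
          {w : InfinitePlace K // w.IsComplex} → ℂ) w' =
        ρ • (Pi.single (⟨w, hw'⟩ : {w : InfinitePlace K // w.IsComplex}) (1 : ℂ) :
          {w : InfinitePlace K // w.IsComplex} → ℂ) w'
      rw [Pi.single_apply, Complex.real_smul]
      split_ifs with h
      · subst h; rw [hx]
      · rw [mul_zero, mul_zero]

end Places

/-! ### Entries and operator norms of elements of `K_∞` -/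

section Kinf

variable {n : ℕ} {K : Type} [Field K] [NumberField K]

-- the scoped `L∞`-operator normed structure on matrices, through which `IsArchSmooth` is defined
open scoped Matrix.Norms.Operator

/-- **Entries of `κ ∈ K_∞` have norm at most one** (each place-component of `κ` is orthogonal or
unitary, `entry_norm_bound_of_unitary`). [folklore] -/
theorem norm_entry_le_one_of_mem_Kinf {κ : GL (Fin n) (mixedSpace K)} (hκ : κ ∈ Kinf n K) (a b : Fin n) :
    ‖(κ : Matrix (Fin n) (Fin n) (mixedSpace K)) a b‖ ≤ 1 := by
  rw [mem_Kinf_iff] at hκ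
  rw [Prod.norm_def]
  refine max_le ?_ ?_
  · refine (pi_norm_le_iff_of_nonneg zero_le_one).2 fun w => ?_
    have h := (mem_unitarySubgroupGL_iff_coe_mem_unitaryGroup _).1 (hκ.1 w)
    have h2 := entry_norm_bound_of_unitary h a b
    exact h2
  · refine (pi_norm_le_iff_of_nonneg zero_le_one).2 fun w => ?_
    have h := (mem_unitarySubgroupGL_iff_coe_mem_unitaryGroup _).1 (hκ.2 w)
    have h2 := entry_norm_bound_of_unitary h a b
    exact h2

set_option backward.isDefEq.respectTransparency false in
/-- A matrix with entries of norm `≤ 1` has `L∞`-operator norm `≤ n`. [folklore] -/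
theorem linfty_opNorm_le_of_forall_norm_entry_le_one {M : Matrix (Fin n) (Fin n) (mixedSpace K)}
    (hM : ∀ a b, ‖M a b‖ ≤ 1) : ‖M‖ ≤ n := by
  rw [Matrix.linfty_opNorm_def]
  have h : ((Finset.univ : Finset (Fin n)).sup fun i : Fin n => ∑ j : Fin n, ‖M i j‖₊) ≤ (n : ℝ≥0) := by
    refine Finset.sup_le fun i _ => ?_
    calc ∑ j : Fin n, ‖M i j‖₊ ≤ ∑ _j : Fin n, (1 : ℝ≥0) :=
          Finset.sum_le_sum fun j _ => by
            have := hM i j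
            rwa [← coe_nnnorm, ← NNReal.coe_one, NNReal.coe_le_coe] at this
      _ = n := by simp
  exact_mod_cast h

set_option backward.isDefEq.respectTransparency false in
/-- **`‖κ‖ ≤ n` for `κ ∈ K_∞`** (`L∞`-operator norm). [folklore] -/
theorem linfty_opNorm_le_of_mem_Kinf {κ : GL (Fin n) (mixedSpace K)} (hκ : κ ∈ Kinf n K) :
    ‖(κ : Matrix (Fin n) (Fin n) (mixedSpace K))‖ ≤ n :=
  linfty_opNorm_le_of_forall_norm_entry_le_one (norm_entry_le_one_of_mem_Kinf hκ)

set_option backward.isDefEq.respectTransparency false in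
/-- `‖single i j c‖ ≤ ‖c‖` for the `L∞`-operator norm. [folklore] -/
theorem linfty_opNorm_single_le (i j : Fin n) (c : mixedSpace K) :
    ‖Matrix.single i j c‖ ≤ ‖c‖ := by
  rw [Matrix.linfty_opNorm_def]
  have h : ((Finset.univ : Finset (Fin n)).sup fun a : Fin n => ∑ b : Fin n, ‖Matrix.single i j c a b‖₊) ≤ ‖c‖₊ := by
    refine Finset.sup_le fun a _ => ?_
    by_cases ha : a = i
    · subst ha
      rw [Finset.sum_eq_single j]
      · rw [Matrix.single_apply_same]
      · intro b _ hb; rw [Matrix.single_apply_of_col_ne a a (Ne.symm hb) c, nnnorm_zero]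
      · intro h; exact absurd (Finset.mem_univ j) h
    · rw [Finset.sum_eq_zero fun b _ => by rw [Matrix.single_apply_of_row_ne (Ne.symm ha) j b c, nnnorm_zero]]
      exact bot_le
  exact_mod_cast h

/-- **Conjugating a matrix unit by a diagonal matrix**: `diag(d)⁻¹ · single i j c · diag(d) =
single i j (dᵢ⁻¹ c dⱼ)`. [folklore] -/
theorem glDiagonal_inv_mul_single_mul_glDiagonal {R : Type*} [CommRing R] (d : Fin n → Rˣ) (i j : Fin n) (c : R) :
    (((glDiagonal n R d)⁻¹ : GL (Fin n) R) : Matrix (Fin n) (Fin n) R) * Matrix.single i j c *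
        ((glDiagonal n R d : GL (Fin n) R) : Matrix (Fin n) (Fin n) R) =
      Matrix.single i j ((((d i)⁻¹ : Rˣ) : R) * c * d j) := by
  rw [← map_inv, coe_glDiagonal, coe_glDiagonal]
  refine Matrix.ext fun a b => ?_
  rw [Matrix.mul_diagonal, Matrix.diagonal_mul, Matrix.single_apply, Matrix.single_apply, Pi.inv_apply]
  split_ifs with h
  · obtain ⟨rfl, rfl⟩ := h; ring
  · rw [mul_zero, zero_mul]

end Kinf

/-! ### The unit block direction and the twisted direction in Iwasawa coordinates -/

section Direction

variable (n k : ℕ) (K : Type) [Field K] [NumberField K]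

/-- **The unit block direction** at the position `(k-1, k)` and the infinite place `w`: the block
coordinate vector with `1_w` at `(k-1, k)` and `0` elsewhere (`0 < k < n`). [folklore] -/
def unitBlockDir (hk0 : 0 < k) (hkn : k < n) (w : InfinitePlace K) : ArchBlockSpace n k K :=
  fun p => if p.1 = ((⟨k - 1, by omega⟩ : Fin n), (⟨k, hkn⟩ : Fin n)) then archUnitAt K w else 0

variable {n k K}

omit [NumberField K] in
/-- The unit block direction at its position is `1_w`. [folklore] -/
theorem unitBlockDir_apply_pos (hk0 : 0 < k) (hkn : k < n) (w : InfinitePlace K) :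
    unitBlockDir n k K hk0 hkn w
        ⟨((⟨k - 1, by omega⟩ : Fin n), (⟨k, hkn⟩ : Fin n)), superdiag_mem_blockPos hk0 hkn⟩ =
      archUnitAt K w := by
  rw [unitBlockDir, if_pos rfl]

omit [NumberField K] in
/-- **The block matrix of the unit block direction is the matrix unit `E^w_{k-1,k}`.** [folklore] -/
theorem blockMatrixOf_unitBlockDir (hk0 : 0 < k) (hkn : k < n) (w : InfinitePlace K) :
    blockMatrixOf n k K (unitBlockDir n k K hk0 hkn w) =
      Matrix.single (⟨k - 1, by omega⟩ : Fin n) (⟨k, hkn⟩ : Fin n) (archUnitAt K w) := by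
  refine Matrix.ext fun i j => ?_
  by_cases h : (i : ℕ) < k ∧ k ≤ (j : ℕ)
  · rw [blockMatrixOf_apply_of_mem _ h, unitBlockDir, Matrix.single_apply]
    by_cases hij : (⟨k - 1, by omega⟩ : Fin n) = i ∧ (⟨k, hkn⟩ : Fin n) = j
    · rw [if_pos (Prod.ext hij.1.symm hij.2.symm), if_pos hij]
    · rw [if_neg (fun h' => hij ⟨(congrArg Prod.fst h').symm, (congrArg Prod.snd h').symm⟩), if_neg hij]
  · rw [blockMatrixOf_apply_of_not _ h, Matrix.single_apply, if_neg]
    rintro ⟨rfl, rfl⟩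
    exact h ⟨by simp; omega, by simp⟩

-- the scoped `L∞`-operator normed structure on matrices, through which `IsArchSmooth` is defined
open scoped Matrix.Norms.Operator

/-- **The twisted direction in Iwasawa coordinates**: if `g_∞ = diag(d) · κ` with `d` real and
positive at `w` (`d_{i,w} = r_i`), then
`Ad(g_∞⁻¹) E^w_{k-1,k} = (r_k / r_{k-1}) · (κ⁻¹ E^w_{k-1,k} κ)`. [folklore] -/
theorem twistedBlockDir_unitBlockDir_eq_smul (hk0 : 0 < k) (hkn : k < n) (w : InfinitePlace K)
    {g : GL (Fin n) (AdeleRing (𝓞 K) K)} {d : Fin n → (mixedSpace K)ˣ} {r : Fin n → ℝ}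
    {κ : GL (Fin n) (mixedSpace K)} (hr : ∀ i, 0 < r i)
    (hd : ∀ i, mixedSpaceEvalAt K w (d i : mixedSpace K) = (r i : ℂ))
    (hg : GLn.toMixed n K g = glDiagonal n (mixedSpace K) d * κ) :
    twistedBlockDir n k K g (unitBlockDir n k K hk0 hkn w) =
      (r ⟨k, hkn⟩ / r ⟨k - 1, by omega⟩) •
        ((((κ⁻¹ : GL (Fin n) (mixedSpace K)) : Matrix (Fin n) (Fin n) (mixedSpace K)) *
          Matrix.single (⟨k - 1, by omega⟩ : Fin n) (⟨k, hkn⟩ : Fin n) (archUnitAt K w) *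
          ((κ : GL (Fin n) (mixedSpace K)) : Matrix (Fin n) (Fin n) (mixedSpace K)))) := by
  rw [twistedBlockDir, hg, blockMatrixOf_unitBlockDir, _root_.mul_inv_rev, Units.val_mul, Units.val_mul]
  set D := glDiagonal n (mixedSpace K) d with hD
  set E := Matrix.single (⟨k - 1, by omega⟩ : Fin n) (⟨k, hkn⟩ : Fin n) (archUnitAt K w) with hE
  have hconj : ((D⁻¹ : GL (Fin n) (mixedSpace K)) : Matrix (Fin n) (Fin n) (mixedSpace K)) * E *
      (D : Matrix (Fin n) (Fin n) (mixedSpace K)) = (r ⟨k, hkn⟩ / r ⟨k - 1, by omega⟩) • E := by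
    rw [hE, hD, glDiagonal_inv_mul_single_mul_glDiagonal]
    have h1 : (((d ⟨k - 1, by omega⟩)⁻¹ : (mixedSpace K)ˣ) : mixedSpace K) * archUnitAt K w *
        (d ⟨k, hkn⟩ : mixedSpace K) = (r ⟨k, hkn⟩ / r ⟨k - 1, by omega⟩) • archUnitAt K w := by
      have h2 : (((d ⟨k - 1, by omega⟩)⁻¹ : (mixedSpace K)ˣ) : mixedSpace K) * archUnitAt K w *
          (d ⟨k, hkn⟩ : mixedSpace K) =
          ((((d ⟨k - 1, by omega⟩)⁻¹ : (mixedSpace K)ˣ) : mixedSpace K) * (d ⟨k, hkn⟩ : mixedSpace K)) *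
            archUnitAt K w := by ring
      rw [h2]
      refine mul_archUnitAt_eq_smul ?_
      have hk1 := hd ⟨k - 1, by omega⟩
      have hk := hd ⟨k, hkn⟩
      have hne : (r ⟨k - 1, by omega⟩ : ℂ) ≠ 0 := Complex.ofReal_ne_zero.2 (hr _).ne'
      have hinv : mixedSpaceEvalAt K w (((d ⟨k - 1, by omega⟩)⁻¹ : (mixedSpace K)ˣ) : mixedSpace K) =
          ((r ⟨k - 1, by omega⟩ : ℂ))⁻¹ := by
        rw [← hk1]
        exact map_units_inv (mixedSpaceEvalAt K w) (d ⟨k - 1, by omega⟩)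
      rw [map_mul, hinv, hk]
      push_cast
      field_simp
    rw [h1, Matrix.smul_single]
  calc ((κ⁻¹ : GL (Fin n) (mixedSpace K)) : Matrix (Fin n) (Fin n) (mixedSpace K)) *
        ((D⁻¹ : GL (Fin n) (mixedSpace K)) : Matrix (Fin n) (Fin n) (mixedSpace K)) * E *
        ((D : Matrix (Fin n) (Fin n) (mixedSpace K)) * (κ : Matrix (Fin n) (Fin n) (mixedSpace K)))
      = ((κ⁻¹ : GL (Fin n) (mixedSpace K)) : Matrix (Fin n) (Fin n) (mixedSpace K)) *
          (((D⁻¹ : GL (Fin n) (mixedSpace K)) : Matrix (Fin n) (Fin n) (mixedSpace K)) * E *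
            (D : Matrix (Fin n) (Fin n) (mixedSpace K))) * (κ : Matrix (Fin n) (Fin n) (mixedSpace K)) := by
        simp only [Matrix.mul_assoc]
    _ = _ := by rw [hconj, Matrix.mul_smul, Matrix.smul_mul]

end Direction

/-! ### The decay estimate -/

section Decay

variable {n k : ℕ} {K : Type} [Field K] [NumberField K]
variable [MeasurableSpace (GL (Fin n) (AdeleRing (𝓞 K) K))] [BorelSpace (GL (Fin n) (AdeleRing (𝓞 K) K))]

-- the scoped `L∞`-operator normed structure on matrices, through which `IsArchSmooth` is defined
open scoped Matrix.Norms.Operator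

set_option backward.isDefEq.respectTransparency false in
/-- **Decay of the Whittaker function in the archimedean Iwasawa coordinates.** Let `φ` be left
`GL_n(K)`-invariant with archimedean-smooth, continuous and bounded iterated Lie derivatives, let
`0 < k < n`, `w` an infinite place and `m : ℕ`. There is `C ≥ 0` such that for every `g ∈ GL_n(𝔸_K)`
whose archimedean component is `g_∞ = diag(d) · κ` with `κ ∈ K_∞` and `d` real positive at `w`
(`d_{i,w} = r_i > 0`): `‖W_φ(g)‖ ≤ C · (r_k / r_{k-1})^m`. Proof: the twisted direction is
`X' = (r_k/r_{k-1}) · Ad(κ⁻¹)E^w_{k-1,k}` (`twistedBlockDir_unitBlockDir_eq_smul`) with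
`‖Ad(κ⁻¹)E^w_{k-1,k}‖ ≤ n²`, so `‖X'^m φ‖_∞ ≤ (r_k/r_{k-1})^m C₀ n^{2m}` (`IterLieDerivUniformBound`), and
`‖W_φ(g)‖ ≤ ‖W_φ(g)‖ (2π Tr 1_w)^m ≤ ‖X'^m φ‖_∞` (`norm_whittakerDepth_zero_mul_pow_le`). This is the
rapid decay of Whittaker functions of smooth vectors in the positive chamber (Cogdell (2004), proof of
Thm. 1.1; Moeglin–Waldspurger (1995), I.2.10–11). [cite: CogdellAnalyticTheory2004, Thm. 1.1] -/
theorem exists_norm_whittakerDepth_zero_le_mul_pow {φ : GL (Fin n) (AdeleRing (𝓞 K) K) → ℂ}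
    (hφK : ∀ (γ₀ : GL (Fin n) K) (x : GL (Fin n) (AdeleRing (𝓞 K) K)),
      φ (Matrix.GeneralLinearGroup.map (algebraMap K (AdeleRing (𝓞 K) K)) γ₀ * x) = φ x)
    (hs : ∀ l : List (archGroupGL n K).lie, IsArchSmooth (glArch n K) (iterLieDeriv (glArch n K) l φ))
    (hc : ∀ l : List (archGroupGL n K).lie, Continuous (iterLieDeriv (glArch n K) l φ))
    (hb : ∀ l : List (archGroupGL n K).lie, ∃ C : ℝ, ∀ z, ‖iterLieDeriv (glArch n K) l φ z‖ ≤ C)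
    (hk0 : 0 < k) (hkn : k < n) (w : InfinitePlace K) (m : ℕ) :
    ∃ C : ℝ, 0 ≤ C ∧ ∀ (g : GL (Fin n) (AdeleRing (𝓞 K) K)) (d : Fin n → (mixedSpace K)ˣ) (r : Fin n → ℝ)
      (κ : GL (Fin n) (mixedSpace K)), (∀ i, 0 < r i) →
      (∀ i, mixedSpaceEvalAt K w (d i : mixedSpace K) = (r i : ℂ)) → κ ∈ Kinf n K →
      GLn.toMixed n K g = glDiagonal n (mixedSpace K) d * κ →
      ‖whittakerDepth 0 φ g‖ ≤ C * (r ⟨k, hkn⟩ / r ⟨k - 1, by omega⟩) ^ m := by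
  have hsm : IsArchSmooth (glArch n K) φ := hs []
  obtain ⟨C₀, hC₀0, hC₀⟩ := norm_iterLieDeriv_ofFn_le_mul_prod (glArch n K) (archGroupGL_lie n K)
    (archGroupGL_carrier n K) hsm hb m
  refine ⟨C₀ * ((n : ℝ) * n) ^ m, by positivity, fun g d r κ hr hd hκ hg => ?_⟩
  -- notation
  set b := unitBlockDir n k K hk0 hkn w with hbdef
  set ρ : ℝ := r ⟨k, hkn⟩ / r ⟨k - 1, by omega⟩ with hρ
  have hρ0 : 0 < ρ := div_pos (hr _) (hr _)
  set Z₁ : Matrix (Fin n) (Fin n) (mixedSpace K) :=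
    (((κ⁻¹ : GL (Fin n) (mixedSpace K)) : Matrix (Fin n) (Fin n) (mixedSpace K)) *
      Matrix.single (⟨k - 1, by omega⟩ : Fin n) (⟨k, hkn⟩ : Fin n) (archUnitAt K w) *
      ((κ : GL (Fin n) (mixedSpace K)) : Matrix (Fin n) (Fin n) (mixedSpace K))) with hZ₁
  have hZ : twistedBlockDir n k K g b = ρ • Z₁ := twistedBlockDir_unitBlockDir_eq_smul hk0 hkn w hr hd hg
  -- the norm of `Z₁`
  have hZ₁norm : ‖Z₁‖ ≤ (n : ℝ) * n := by
    have h1 : ‖((κ⁻¹ : GL (Fin n) (mixedSpace K)) : Matrix (Fin n) (Fin n) (mixedSpace K)) *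
        Matrix.single (⟨k - 1, by omega⟩ : Fin n) (⟨k, hkn⟩ : Fin n) (archUnitAt K w)‖ ≤ n * 1 := by
      refine (Matrix.linfty_opNorm_mul _ _).trans (mul_le_mul (linfty_opNorm_le_of_mem_Kinf (inv_mem hκ))
        ((linfty_opNorm_single_le _ _ _).trans (norm_archUnitAt_le w)) (norm_nonneg _) (Nat.cast_nonneg _))
    rw [mul_one] at h1
    rw [hZ₁]
    exact (Matrix.linfty_opNorm_mul _ _).trans (mul_le_mul h1 (linfty_opNorm_le_of_mem_Kinf hκ)
      (norm_nonneg _) (Nat.cast_nonneg _))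
  -- the bound on `X'^m φ`
  have hM : ∀ z, ‖iterLieDeriv (glArch n K) (List.replicate m (lieOf (twistedBlockDir n k K g b))) φ z‖ ≤
      ρ ^ m * (C₀ * ((n : ℝ) * n) ^ m) := by
    intro z
    have e1 : lieOf (twistedBlockDir n k K g b) = RealMatrixGroup.lieOfTop (archGroupGL_lie n K) (ρ • Z₁) := by
      rw [hZ]; rfl
    rw [e1, iterLieDeriv_replicate_smul (glArch n K) (archGroupGL_lie n K) (archGroupGL_carrier n K) hsm ρ Z₁ m z,
      _root_.norm_smul, Real.norm_eq_abs, abs_of_pos (pow_pos hρ0 m)]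
    refine mul_le_mul_of_nonneg_left ?_ (pow_pos hρ0 m).le
    have h2 := hC₀ (fun _ : Fin m => Z₁) z
    rw [List.ofFn_const] at h2
    refine h2.trans (mul_le_mul_of_nonneg_left ?_ hC₀0)
    rw [Finset.prod_const, Finset.card_univ, Fintype.card_fin]
    exact pow_le_pow_left₀ (norm_nonneg _) hZ₁norm m
  -- the basic inequality and the lower bound `1 ≤ 2π Tr(1_w)`
  have key := norm_whittakerDepth_zero_mul_pow_le hφK hs hc hk0 hkn g b m hM
  have hTr : 1 ≤ 2 * π * |mixedTrace K (b ⟨((⟨k - 1, by omega⟩ : Fin n), (⟨k, hkn⟩ : Fin n)),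
      superdiag_mem_blockPos hk0 hkn⟩)| := by
    rw [hbdef, unitBlockDir_apply_pos]
    have h1 := one_le_mixedTrace_archUnitAt (K := K) w
    rw [abs_of_pos (lt_of_lt_of_le zero_lt_one h1)]
    have hπ : 1 ≤ 2 * π := by linarith [Real.pi_gt_three]
    nlinarith
  have hpow : 1 ≤ (2 * π * |mixedTrace K (b ⟨((⟨k - 1, by omega⟩ : Fin n), (⟨k, hkn⟩ : Fin n)),
      superdiag_mem_blockPos hk0 hkn⟩)|) ^ m := one_le_pow₀ hTr
  calc ‖whittakerDepth 0 φ g‖ ≤ ‖whittakerDepth 0 φ g‖ * (2 * π * |mixedTrace K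
        (b ⟨((⟨k - 1, by omega⟩ : Fin n), (⟨k, hkn⟩ : Fin n)), superdiag_mem_blockPos hk0 hkn⟩)|) ^ m :=
        le_mul_of_one_le_right (norm_nonneg _) hpow
    _ ≤ ρ ^ m * (C₀ * ((n : ℝ) * n) ^ m) := key
    _ = C₀ * ((n : ℝ) * n) ^ m * ρ ^ m := by ring

end Decay

end Literature.NumberTheory.Automorphic
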